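import Summits.SmoothPoincare4.SmoothPoincare4.Theorems.ConvexBisectionAcyclicBisectionExistsDualLinkSeamPush
import HarnessLib

/-!
# Dual handles, T3c-3: the dual framed knots, page directions and suffix letters
(sub-goal T3c-3 `node_dualLink_pageLink` of stub `stub_steinRealisation` (NF6), line
`modp-braid-orbits` r11, crux `ConvexBisection.AcyclicBisectionExists`, item stmt-SmoothPoincare4-10508;
wave 3, lead c5; registered sub-goal `helper_attachingFraming_dualMap`)

Sequel of `…DualHandlePlumbing.lean` (`pushedMap`, `dualMap`, `attachingCircle_pushedMap`) and
`…DualLinkSeamPush.lean` (the seam push `y ↦ (G y : W)`).  Here: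

* §1 **the dual framed knots** (piece (a) of node T3c-3): the handle framing of an attaching map is,
  after dropping the normal coordinate, the fibre derivative of its boundary tube
  (`tail_attachingFraming_eq_mfderiv_boundaryTube`: along `s ↦ (cos s θ, sin s, 0)` the attaching
  map is `s ↦ h♭ (θ, sin s e₀)`, `tubeArcPt_eq_depthLine`), so the handle framing of the pushed map
  `pushedMap q₀ G col κ δ` is `κ • d(G)(tail of the handle framing of q₀)` at the lifted attaching
  circle (`attachingFraming_pushedMap`: along the arc the pushed map is `s ↦ G (q₀♭ (θ, κ sin s e₀))`,
  `TubeAttachData.attachingMap_tubeArcPt`); for the dual maps: `helper_attachingFraming_dualMap`;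
* §2 bookkeeping: `pageDir n` is injective on `k < n` (`pageDir_injOn`, proof from the wave-1 design
  file `NF4_Design.lean` §0), and the suffix letters of `P ++ N` (`get_append_natAdd`).

Everything is proved; no named facts, no `sorry`.

## References
* J. Milnor, *Lectures on the h-cobordism theorem* (1965), §3 (dual handles). [MilnorHCobordism1965]
* A. A. Kosinski, *Differential Manifolds* (1993), VI §6. [Kosinski1993]
-/

noncomputable section

-- the prescribed namespace `Summit.<P>.<Sub>.…` duplicates `SmoothPoincare4` (P = Sub)
set_option linter.dupNamespace false

open scoped Manifold ContDiff Topology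

namespace Summit.SmoothPoincare4.SmoothPoincare4.Theorems.AcyclicBisectionExists.ModpBraidOrbits

open Set Function Filter Metric Topology Bundle
open Literature.Topology.FourManifolds Literature.Topology.FourManifolds.HandleAttachingMap
  Literature.Topology.FourManifolds.BoundaryManifold Literature.Topology.FourManifolds.LefschetzBase
  Literature.Geometry.Symplectic

/-! ## §1 The dual framed knots -/

section DualFraming

variable {X : Type} [TopologicalSpace X] [ChartedSpace (EuclideanHalfSpace 4) X] [IsManifold (𝓡∂ 4) ∞ X]
  {W : Type} [TopologicalSpace W] [ChartedSpace (EuclideanHalfSpace 4) W] [IsManifold (𝓡∂ 4) ∞ W]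

/-- **The handle framing of an attaching map read in its boundary tube**: along `s ↦ (cos s θ, sin s, 0)`
the attaching map is `s ↦ h♭ (θ, sin s e₀)` (`tubeArcPt_eq_depthLine`), so the handle framing is
`(0, ∂_w h♭(θ, 0) e₀)`: its tail is the fibre derivative of the boundary tube. [folklore] -/
theorem tail_attachingFraming_eq_mfderiv_boundaryTube (q₀ : HandleAttachingMap 3 2 X)
    (θ : sphere (0 : EuclideanSpace ℝ (Fin 2)) 1) :
    tail 3 (q₀.attachingFraming θ) =
      mfderiv 𝓘(ℝ, EuclideanSpace ℝ (Fin 2)) (𝓡 3)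
        (fun v : EuclideanSpace ℝ (Fin 2) => q₀.boundaryTube.toHomeo (θ, v)) 0 planeE0 := by
  -- the fibre map of the boundary tube and its derivative at `0`
  set c : EuclideanSpace ℝ (Fin 2) → (BoundaryManifold.boundaryData 3 X).carrier :=
    fun v => q₀.boundaryTube.toHomeo (θ, v) with hc
  have hcs : ContMDiffAt 𝓘(ℝ, EuclideanSpace ℝ (Fin 2)) (𝓡 3) ∞ c 0 :=
    (q₀.boundaryTube.contMDiffAt_toHomeo (q₀.boundaryTube.mem_source_zero θ)).comp 0
      (contMDiffAt_const.prodMk contMDiffAt_id)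
  set Dc : EuclideanSpace ℝ (Fin 2) →L[ℝ] EuclideanSpace ℝ (Fin 3) :=
    mfderiv 𝓘(ℝ, EuclideanSpace ℝ (Fin 2)) (𝓡 3) c 0 with hDc
  have hcd : HasMFDerivAt 𝓘(ℝ, EuclideanSpace ℝ (Fin 2)) (𝓡 3) c 0 Dc :=
    (hcs.mdifferentiableAt (by simp)).hasMFDerivAt
  -- the parametrisation `r s = sin s • e₀` of the fibre direction
  set r : ℝ → EuclideanSpace ℝ (Fin 2) := fun s => Real.sin s • planeE0 with hr
  have hr0 : r 0 = 0 := by simp [hr]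
  have hrd : HasMFDerivAt 𝓘(ℝ, ℝ) 𝓘(ℝ, EuclideanSpace ℝ (Fin 2)) r 0
      (ContinuousLinearMap.smulRight (1 : ℝ →L[ℝ] ℝ) planeE0) := by
    have h := ((Real.hasDerivAt_sin 0).smul_const planeE0).hasFDerivAt.hasMFDerivAt
    simp only [Real.cos_zero, one_smul] at h
    exact h
  have hcd' : HasMFDerivAt 𝓘(ℝ, EuclideanSpace ℝ (Fin 2)) (𝓡 3) c (r 0) Dc := by rw [hr0]; exact hcd
  have hincl : HasMFDerivAt (𝓡 3) (𝓡∂ 4) (BoundaryManifold.boundaryData 3 X).incl (c (r 0)) (consZeroL 3) :=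
    hasMFDerivAt_incl_boundaryData (n := 3) _
  have hcomp := hincl.comp 0 (hcd'.comp 0 hrd)
  -- the handle framing is the velocity of `h̄` along the arc, which is this composite near `0`
  have hev : (q₀.toFun ∘ tubeArcPt θ) =ᶠ[𝓝 0]
      ((BoundaryManifold.boundaryData 3 X).incl ∘ c ∘ r) := by
    filter_upwards [eventually_cos_pos] with s hs
    show q₀.toFun (tubeArcPt θ s) = (BoundaryManifold.boundaryData 3 X).incl (q₀.boundaryTube.toHomeo (θ, r s))
    rw [tubeArcPt_eq_depthLine hs]
    rfl
  rw [attachingFraming_eq_mfderiv_comp_tubeArcPt, hev.mfderiv_eq, hcomp.mfderiv]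
  show tail 3 (consZeroL 3 (Dc (((1 : ℝ →L[ℝ] ℝ) (1 : ℝ)) • planeE0))) = Dc planeE0
  rw [tail_consZeroL]
  simp

/-- **The handle framing of the pushed attaching map**: `κ • d(G)(tail of the handle framing of q₀)`
at the lifted attaching circle — along the arc the pushed map is `s ↦ G (q₀♭ (θ, κ sin s e₀))`
(`TubeAttachData.attachingMap_tubeArcPt`). [cite: Kosinski1993, VI §6] -/
theorem attachingFraming_pushedMap (q₀ : HandleAttachingMap 3 2 X)
    (G : (BoundaryManifold.boundaryData 3 X).carrier ≃ₘ⟮𝓡 3, 𝓡 3⟯ (BoundaryManifold.boundaryData 3 W).carrier)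
    (col : (BoundaryManifold.boundaryData 3 W).Collar) (κ δ : ℝ) (hκ : 0 < κ) (hκ1 : κ ≤ 1) (hδ : 0 < δ)
    (hδ2 : δ ≤ 1 / 2) (θ : sphere (0 : EuclideanSpace ℝ (Fin 2)) 1) :
    (pushedMap q₀ G col κ δ hκ hκ1 hδ hδ2).attachingFraming θ =
      κ • mfderiv (𝓡 3) (𝓡∂ 4) (fun y => (BoundaryManifold.boundaryData 3 W).incl (G y))
        ⟨q₀.attachingCircle θ, q₀.isBoundaryPoint_attachingCircle θ⟩ (tail 3 (q₀.attachingFraming θ)) := by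
  rw [tail_attachingFraming_eq_mfderiv_boundaryTube]
  -- the fibre map of the boundary tube and its derivative at `0`
  set c : EuclideanSpace ℝ (Fin 2) → (BoundaryManifold.boundaryData 3 X).carrier :=
    fun v => q₀.boundaryTube.toHomeo (θ, v) with hc
  have hcs : ContMDiffAt 𝓘(ℝ, EuclideanSpace ℝ (Fin 2)) (𝓡 3) ∞ c 0 :=
    (q₀.boundaryTube.contMDiffAt_toHomeo (q₀.boundaryTube.mem_source_zero θ)).comp 0
      (contMDiffAt_const.prodMk contMDiffAt_id)
  set Dc : EuclideanSpace ℝ (Fin 2) →L[ℝ] EuclideanSpace ℝ (Fin 3) :=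
    mfderiv 𝓘(ℝ, EuclideanSpace ℝ (Fin 2)) (𝓡 3) c 0 with hDc
  have hcd : HasMFDerivAt 𝓘(ℝ, EuclideanSpace ℝ (Fin 2)) (𝓡 3) c 0 Dc :=
    (hcs.mdifferentiableAt (by simp)).hasMFDerivAt
  have hc0 : c 0 = ⟨q₀.attachingCircle θ, q₀.isBoundaryPoint_attachingCircle θ⟩ :=
    Subtype.ext (q₀.coe_boundaryTube_core θ)
  -- the seam push and its derivative at the lifted attaching circle
  set Dσ : EuclideanSpace ℝ (Fin 3) →L[ℝ] EuclideanSpace ℝ (Fin 4) :=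
    mfderiv (𝓡 3) (𝓡∂ 4) (fun y => (BoundaryManifold.boundaryData 3 W).incl (G y))
      ⟨q₀.attachingCircle θ, q₀.isBoundaryPoint_attachingCircle θ⟩ with hDσ
  -- the parametrisation `r s = κ • sin s • e₀` of the fibre direction
  set r : ℝ → EuclideanSpace ℝ (Fin 2) := fun s => κ • (Real.sin s • planeE0) with hr
  have hr0 : r 0 = 0 := by simp [hr]
  have hrd : HasMFDerivAt 𝓘(ℝ, ℝ) 𝓘(ℝ, EuclideanSpace ℝ (Fin 2)) r 0
      (ContinuousLinearMap.smulRight (1 : ℝ →L[ℝ] ℝ) (κ • planeE0)) := by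
    have h := (((Real.hasDerivAt_sin 0).smul_const planeE0).const_smul κ).hasFDerivAt.hasMFDerivAt
    simp only [Real.cos_zero, one_smul] at h
    exact h
  have hcd' : HasMFDerivAt 𝓘(ℝ, EuclideanSpace ℝ (Fin 2)) (𝓡 3) c (r 0) Dc := by rw [hr0]; exact hcd
  have hσ : HasMFDerivAt (𝓡 3) (𝓡∂ 4) (fun y => (BoundaryManifold.boundaryData 3 W).incl (G y))
      (c (r 0)) Dσ := by
    rw [hr0, hc0]
    exact ((contMDiff_seamPush G _).mdifferentiableAt (by simp)).hasMFDerivAt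
  have hcomp := hσ.comp 0 (hcd'.comp 0 hrd)
  -- the handle framing of the pushed map is the velocity along the arc, which is this composite
  have hev : ((pushedMap q₀ G col κ δ hκ hκ1 hδ hδ2).toFun ∘ tubeArcPt θ) =ᶠ[𝓝 0]
      ((fun y => (BoundaryManifold.boundaryData 3 W).incl (G y)) ∘ c ∘ r) := by
    refine ((pushedTubeData q₀ G col κ δ hκ hκ1 hδ hδ2).attachingMap_tubeArcPt_eventuallyEq θ).trans
      (Eventually.of_forall fun s => ?_)
    show (BoundaryManifold.boundaryData 3 W).incl ((q₀.boundaryTube.mapDiffeo G).toHomeo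
      (θ, κ • (Real.sin s • EuclideanSpace.single (0 : Fin 2) (1 : ℝ)))) = _
    rw [CircleTube.mapDiffeo_apply]
    rfl
  rw [attachingFraming_eq_mfderiv_comp_tubeArcPt, hev.mfderiv_eq, hcomp.mfderiv]
  show Dσ (Dc (((1 : ℝ →L[ℝ] ℝ) (1 : ℝ)) • (κ • planeE0))) = κ • Dσ (Dc planeE0)
  rw [← map_smul, ← map_smul]
  congr 2
  simp

end DualFraming

/-- **Sub-goal `helper_attachingFraming_dualMap` of stub `stub_steinRealisation`** (NF6 ▸ T3 ▸ T3c-3,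
piece (a); wave 3, lead c5): **the handle framing of the dual attaching map** of the `j`-th handle of
`X = B ∪_{h̄} (handles)` on the other piece `W` of a gluing along `Ψ : bX.carrier ≅ bW.carrier` is
`κ • d(seamDiffeo bX bW Ψ)(tail of the handle framing of the belt map)` at the lifted belt circle
(the push by the differential of `y ↦ (seamDiffeo bX bW Ψ y : W)`; `tail` drops the normal
coordinate of the belt framing, which is tangent to `∂X`). [cite: MilnorHCobordism1965, §3] -/
theorem helper_attachingFraming_dualMap : ∀ {B : Type} [TopologicalSpace B] [T2Space B] [ChartedSpace (EuclideanHalfSpace 4) B] {ι : Type} [Finite ι] {h : ι → Literature.Topology.FourManifolds.HandleAttachingMap 3 2 B} {X : Type} [TopologicalSpace X] [ChartedSpace (EuclideanHalfSpace 4) X] [IsManifold (𝓡∂ 4) ∞ X] {W : Type} [TopologicalSpace W] [ChartedSpace (EuclideanHalfSpace 4) W] [IsManifold (𝓡∂ 4) ∞ W] (D : Literature.Topology.FourManifolds.HandleAttachingMap.MultiAttachmentData h (𝓡∂ 4) X) (bX : Literature.Topology.FourManifolds.BoundaryData (𝓡∂ 4) X (𝓡 3)) (bW : Literature.Topology.FourManifolds.BoundaryData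 (𝓡∂ 4) W (𝓡 3)) (Ψ : bX.carrier ≃ₘ⟮𝓡 3, 𝓡 3⟯ bW.carrier) (col : (Literature.Topology.FourManifolds.BoundaryManifold.boundaryData 3 W).Collar) (κ δ : ℝ) (hκ : 0 < κ) (hκ1 : κ ≤ 1) (hδ : 0 < δ) (hδ2 : δ ≤ 1 / 2) (j : ι) (θ : Metric.sphere (0 : EuclideanSpace ℝ (Fin 2)) 1), (Summit.SmoothPoincare4.SmoothPoincare4.Theorems.AcyclicBisectionExists.ModpBraidOrbits.dualMap D bX bW Ψ col κ δ hκ hκ1 hδ hδ2 j).attachingFraming θ = κ • mfderiv (𝓡 3) (𝓡∂ 4) (fun y => (Literature.Topology.FourManifolds.BoundaryManifold.boundaryData 3 W).incl (Summit.SmoothPoincare4.SmoothPoincare4.Theorems.AcyclicBisectionExists.ModpBraidOrbits.seamDiffeo bX bW Ψ y)) ⟨(Summit.SmoothPoincare4.SmoothPoincare4.Theorems.AcyclicBisectionExists.ModpBraidOrbits.beltMap D j).attachingCircle θ, (Summit.SmoothPoincare4.SmoothPoincare4.Theorems.AcyclicBisectionExists.ModpBraidOrbits.beltMap D j).isBoundaryPoint_attachingCircle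 θ⟩ (Literature.Topology.FourManifolds.BoundaryManifold.tail 3 ((Summit.SmoothPoincare4.SmoothPoincare4.Theorems.AcyclicBisectionExists.ModpBraidOrbits.beltMap D j).attachingFraming θ)) :=
  fun D bX bW Ψ col κ δ hκ hκ1 hδ hδ2 j θ =>
    attachingFraming_pushedMap (beltMap D j) (seamDiffeo bX bW Ψ) col κ δ hκ hκ1 hδ hδ2 θ

/-! ## §2 Bookkeeping: page directions and suffix letters -/

section Bookkeeping

/-- **Distinct positions give distinct page directions**: `pageDir n` is injective on `k < n` (the
angles `-2π(k + ½)/n`, `k < n`, are pairwise incongruent mod `2π`; proof from the design file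
`NF4_Design.lean` §0 of wave 1). [folklore] -/
theorem pageDir_injOn {n k₁ k₂ : ℕ} (h₁ : k₁ < n) (h₂ : k₂ < n) (h : pageDir n k₁ = pageDir n k₂) :
    k₁ = k₂ := by
  have hn : (0 : ℝ) < n := by exact_mod_cast (Nat.lt_of_le_of_lt (Nat.zero_le _) h₁)
  have e₁ : pageDir n k₁ = Complex.exp (((-(2 * Real.pi * (k₁ + 1 / 2) / n) : ℝ)) * Complex.I) := rfl
  have e₂ : pageDir n k₂ = Complex.exp (((-(2 * Real.pi * (k₂ + 1 / 2) / n) : ℝ)) * Complex.I) := rfl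
  rw [e₁, e₂, Complex.exp_eq_exp_iff_exists_int] at h
  obtain ⟨m, hm⟩ := h
  have hre : (-(2 * Real.pi * (k₁ + 1 / 2) / n) : ℝ) = -(2 * Real.pi * (k₂ + 1 / 2) / n) + m * (2 * Real.pi) := by
    have := congrArg Complex.im hm
    simpa using this
  have hk : (k₂ : ℝ) - k₁ = m * n := by
    field_simp at hre
    nlinarith [Real.pi_pos]
  have hk' : (k₂ : ℤ) - k₁ = m * n := by exact_mod_cast hk
  have hb : |(k₂ : ℤ) - k₁| < n := by
    rw [abs_lt]; constructor <;> omega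
  rw [hk', abs_mul, Nat.abs_cast] at hb
  have hm0 : m = 0 := by
    by_contra hmne
    have : (1 : ℤ) * n ≤ |m| * n :=
      mul_le_mul_of_nonneg_right (Int.one_le_abs hmne) (by positivity)
    omega
  subst hm0
  simp at hk'
  omega

/-- The suffix letters of `P ++ N`: position `|P| + j` carries the `j`-th letter of `N`. [folklore] -/
theorem get_append_natAdd {α : Type*} (P N : List α) (j : Fin N.length) :
    (P ++ N).get (Fin.cast List.length_append.symm (Fin.natAdd P.length j)) = N.get j := by
  simp [List.getElem_append_right]

end Bookkeeping

end Summit.SmoothPoincare4.SmoothPoincare4.Theorems.AcyclicBisectionExists.ModpBraidOrbits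

end
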